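import Literature.NumberTheory.ComplexMultiplication.MainTheoremCMLevelQMultiplication
import Literature.NumberTheory.ComplexMultiplication.CMTypeUniformizationToBaseChange
import Literature.AlgebraicGeometry.Motives.AbelianVarietyHomComplexGaloisDescent
import HarnessLib

/-!
# The `S(γ)`-multiplications `A → B` are ALL rational over the field of definition as soon as ONE of them is
# (Shimura 1998, §7.4 Prop. 15 and §18.6 p. 129 «with isogenies `λ` and `μ` … rational over `k`»; no `hAB` hypothesis)

Topic `Literature/NumberTheory/ComplexMultiplication`, namespace
`Literature.NumberTheory.ComplexMultiplication.CMTypeUniformization`.  THEOREMS ONLY (no definition, no named fact, no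
instance; net Literature debt 0).  Cell `hodgecm-mathlib` (D-0151), fan B-II line E2 toward row F-S2₁′
(`shimuraTaniyamaPair_degOne'`), A-p02's ASM skeleton / A-p08's μ-free road: the named fact hands ONE `k`-rational
`𝔮`-multiplication `λ : A → B` («`λ(ξ(q(u))) = η(q(u))`», i.e. `λ` induces `S(1)` on the uniformisations `ξ`, `η` of
types `𝔞`, `𝔟 = 𝔮⁻¹𝔞`), and the road decomposes `λ = Σᵢ ι_A(αᵢ) λ_{γᵢ}` through the OTHER multiplications
`λ_γ : A → B`, `γ ∈ 𝔞⁻¹𝔟 = 𝔮⁻¹` — which must therefore be `k`-rational too.  The tree's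
`exists_hom_baseChange_map_r_eq` (`CMTypeUniformizationDescendedMultiplications` §2) produces `λ_γ` over `k` only under
`hAB` («every `ℂ`-homomorphism `A ⊗ ℂ → B ⊗ ℂ` is defined over `k`»), which the named fact does not supply.  Here
`hAB` is replaced by the one given `λ` (any parameter `c₀ ≠ 0`):

* §1 (base-change shape, `k ⊆ ℂ` countable) **`exists_hom_baseChange_map_r_eq_of_hom`** — from `λ : A → B` over `k`
  with `λ_ℂ(ξ.r u) = η.r (c₀ u)`, `c₀ ≠ 0`, every `γ ∈ 𝔞⁻¹𝔟` has a `k`-HOMOMORPHISM `λ_γ : A → B`, `𝔬_K`-linear, with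
  `(λ_γ)_ℂ(ξ.r u) = η.r (γ u)`; unique (`existsUnique_hom_baseChange_map_r_eq_of_hom`).  PROOF: over `ℂ` the
  holomorphic `S(γ)` is a homomorphism `ν : A_ℂ → B_ℂ` (GAGA, tree `exists_hom_forall_map_r_eq`, [Shimura1998] §7.4
  Prop. 15); writing `n γ = c₀ b` with `n ∈ ℕ ∖ 0`, `b ∈ 𝔬_K` one has `[n]_ℂ ≫ ν = (ι_A(b) ≫ λ)_ℂ` (both induce
  `S(nγ) = S(c₀ b)`; torsion points separate homomorphisms, `hom_ext_of_forall_r`), and a complex homomorphism `ν` with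
  `f_ℂ ≫ ν = g_ℂ`, `f` a `k`-ISOGENY, is defined over `k` ([Milne2005ShimuraVarieties] Prop. 13.1 + epi-cancellation:
  tree `exists_baseChange_eq_comp_eq_of_isIsogeny_complex`).
* §2 (`k`-shape = the binders of the named fact) **`exists_hom_map_r_eq_of_hom`**, `exists_hom_map_r_eq_of_map_r_eq`
  (`c₀ = 1`: LITERALLY the hypothesis `_hlam` of `shimuraTaniyamaPair_degOne'`) — the same over `k`-shape
  uniformisations `ξ₀ : CMTypeUniformization Φ 𝔞 A ιA` (through `CMTypeUniformizationToBaseChange`).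
* §0 bookkeeping: `inv_mul_eq_inv_coeIdeal_of_coeIdeal_mul_eq` (`𝔮𝔟 = 𝔞 ⇒ 𝔞⁻¹𝔟 = 𝔮⁻¹`),
  `exists_nat_mul_eq_mul_coe` (`n γ = c₀ b`).

## References
* [Shimura1998] G. Shimura, *Abelian Varieties with Complex Multiplication and Modular Functions*, Princeton 1998, §7.4
  Prop. 15 p. 58 («`S(γ)` represents a `(γ𝔟⁻¹𝔞)`-multiplication»); §18.6 proof of Thm. 18.6 pp. 128–129 (the
  diagram «with isogenies `λ` and `μ`», all maps rational over the number field of definition); Ch. I §1.2 p. 4.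
* [Milne2005ShimuraVarieties] J. S. Milne, *Introduction to Shimura Varieties* (2005/2017), §13 Prop. 13.1 p. 117.
* [MumfordAV1970] D. Mumford, *Abelian Varieties* (1970), §6 Application 3 (`[n]` is an isogeny), §19 Thm. 3.
-/

set_option autoImplicit false

noncomputable section

open CategoryTheory NumberField Cardinal
open scoped NumberField nonZeroDivisors

namespace Literature.NumberTheory.ComplexMultiplication

open Literature.AlgebraicGeometry.Motives (CMType AbelianVariety AlgPoints)
open Literature.AlgebraicGeometry.Motives.AbelianVariety

namespace CMTypeUniformization

/-! ## §0 Bookkeeping -/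

section Arith

variable {K : Type} [Field K] [NumberField K]

/-- **`𝔮 𝔟 = 𝔞 ⇒ 𝔞⁻¹𝔟 = 𝔮⁻¹`**: the parameters `γ` of the multiplications `(A, 𝔞) → (B, 𝔟)` are exactly the
elements of `𝔮⁻¹` when `B` is the `𝔮`-transform. [cite: Shimura1998, §7.4 Prop. 15, p. 58; §18.6 p. 128] -/
theorem inv_mul_eq_inv_coeIdeal_of_coeIdeal_mul_eq (𝔞 𝔟 : (FractionalIdeal (𝓞 K)⁰ K)ˣ) (𝔮 : Ideal (𝓞 K))
    (h𝔮𝔟 : (𝔮 : FractionalIdeal (𝓞 K)⁰ K) * (𝔟 : FractionalIdeal (𝓞 K)⁰ K) = 𝔞) :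
    ((𝔞 : FractionalIdeal (𝓞 K)⁰ K)⁻¹ * 𝔟 : FractionalIdeal (𝓞 K)⁰ K) = (𝔮 : FractionalIdeal (𝓞 K)⁰ K)⁻¹ := by
  rw [← h𝔮𝔟, mul_inv, mul_assoc, inv_mul_cancel₀ (𝔟.ne_zero), mul_one]

/-- **`n γ = c₀ b` with `n ∈ ℕ ∖ 0`, `b ∈ 𝔬_K`**, for `γ ∈ K` and `c₀ ∈ K ∖ 0` (`γ / c₀ = b′ / a′` with `a′, b′ ∈ 𝔬_K`,
then `n := N(a′ 𝔬_K) = c a′`).  The integer `n` is what makes `[n] = ι(n)` an isogeny available without any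
hypothesis on the structure. [cite: Shimura1998, §5.1 Prop. 1 (𝔬_K-multiplications), §7.4 Prop. 15 p. 58] -/
theorem exists_nat_mul_eq_mul_coe (γ : K) {c₀ : K} (hc₀ : c₀ ≠ 0) :
    ∃ (n : ℕ) (b : 𝓞 K), n ≠ 0 ∧ (n : K) * γ = c₀ * (b : K) := by
  classical
  obtain ⟨⟨b', a'⟩, hab⟩ := IsLocalization.surj (nonZeroDivisors (𝓞 K)) (S := K) (γ / c₀)
  simp only at hab
  -- `hab : γ / c₀ * algebraMap (𝓞 K) K a' = algebraMap (𝓞 K) K b'`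
  have ha'0 : (a' : 𝓞 K) ≠ 0 := nonZeroDivisors.coe_ne_zero a'
  set n : ℕ := Ideal.absNorm (Ideal.span ({(a' : 𝓞 K)} : Set (𝓞 K))) with hn
  have hn0 : n ≠ 0 := by
    rw [hn, Ne, Ideal.absNorm_eq_zero_iff, Ideal.span_singleton_eq_bot]
    exact ha'0
  obtain ⟨c, hc⟩ : ∃ c : 𝓞 K, c * (a' : 𝓞 K) = (n : 𝓞 K) :=
    Ideal.mem_span_singleton'.1 (Ideal.absNorm_mem (Ideal.span ({(a' : 𝓞 K)} : Set (𝓞 K))))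
  refine ⟨n, c * b', hn0, ?_⟩
  have hcK : algebraMap (𝓞 K) K c * algebraMap (𝓞 K) K (a' : 𝓞 K) = (n : K) := by
    rw [← map_mul, hc, map_natCast]
  change (n : K) * γ = c₀ * algebraMap (𝓞 K) K (c * b')
  calc (n : K) * γ = algebraMap (𝓞 K) K c * algebraMap (𝓞 K) K (a' : 𝓞 K) * (γ / c₀ * c₀) := by
          rw [hcK, div_mul_cancel₀ γ hc₀]
    _ = c₀ * (algebraMap (𝓞 K) K c * (γ / c₀ * algebraMap (𝓞 K) K (a' : 𝓞 K))) := by ring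
    _ = c₀ * algebraMap (𝓞 K) K (c * b') := by rw [hab, map_mul]

end Arith

/-! ## §1 Base-change shape: every `S(γ)` is `k`-rational once one `k`-rational multiplication is given -/

section BaseChangeShape

variable {K : Type} [Field K] [NumberField K] {Φ : CMType K} {𝔞 𝔟 : (FractionalIdeal (𝓞 K)⁰ K)ˣ}
  {k : Type} [Field k] [Algebra k ℂ] {A B : AbelianVariety k}
  {ιA : 𝓞 K →+* End A} {ιB : 𝓞 K →+* End B}
  (ξ : CMTypeUniformization Φ 𝔞 (A.baseChange ℂ) ((endBaseChange ℂ A).comp ιA))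
  (η : CMTypeUniformization Φ 𝔟 (B.baseChange ℂ) ((endBaseChange ℂ B).comp ιB))

omit [NumberField K] [Algebra k ℂ] in
/-- `ι(n) = [n]` for a natural number `n` (the `𝔬_K`-action restricted to `ℤ`). [cite: Shimura1998, §5.1 Prop. 1, p. 36] -/
theorem ι_natCast_eq_nsmul (ι : 𝓞 K →+* End A) (n : ℕ) : (ι (n : 𝓞 K) : A ⟶ A) = n • 𝟙 A := by
  rw [map_natCast, ← Nat.smul_one_eq_cast]
  rfl

omit [NumberField K] in
/-- **`ι(n) = [n]` is an isogeny for `n ≠ 0`** over a field `k ⊆ ℂ` (characteristic `0`; Mumford §6 Application 3).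
[cite: MumfordAV1970, §6 Application 3 (p. 64)] -/
theorem isIsogeny_ι_natCast (ι : 𝓞 K →+* End A) {n : ℕ} (hn : n ≠ 0) : IsIsogeny (ι (n : 𝓞 K) : A ⟶ A) := by
  haveI : CharZero k := (algebraMap k ℂ).charZero
  rw [ι_natCast_eq_nsmul]
  exact isIsogeny_nsmul_id_of_cast_ne_zero A n (Nat.cast_ne_zero.2 hn)

/-- **All `S(γ)`-multiplications `A → B` are rational over `k` as soon as one is** ([Shimura1998] §7.4 Prop. 15 with
§18.6 p. 129; no `hAB`).  Let `k ⊆ ℂ` be countable, `(A, ι_A)`, `(B, ι_B)` over `k` with base-change uniformisations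
`ξ`, `η` of types `(K, Φ, 𝔞)`, `(K, Φ, 𝔟)`, and let `λ : A → B` be a `k`-homomorphism inducing `S(c₀)`, `c₀ ≠ 0`
(`λ_ℂ(ξ.r u) = η.r (c₀ u)`; the `𝔮`-multiplication of the named fact `shimuraTaniyamaPair_degOne'` has `c₀ = 1`).  Then for
every `γ ∈ 𝔞⁻¹𝔟` there is a `k`-homomorphism `λ_γ : A → B`, `𝔬_K`-linear, with `(λ_γ)_ℂ(ξ.r u) = η.r (γ u)`.  Proof:
`ν := S(γ)` is a homomorphism `A_ℂ → B_ℂ` (GAGA, `exists_hom_forall_map_r_eq`); with `n γ = c₀ b` (`exists_nat_mul_eq_mul_coe`)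
both `ι_A(n)_ℂ ≫ ν` and `(ι_A(b) ≫ λ)_ℂ` induce `S(nγ)`, so they are equal (`hom_ext_of_forall_r`); `ι_A(n) = [n]` is a
`k`-isogeny, hence `ν` descends (`exists_baseChange_eq_comp_eq_of_isIsogeny_complex`, [Milne2005ShimuraVarieties] Prop. 13.1);
`𝔬_K`-linearity by `comp_eq_comp_of_forall_baseChange_map_r_eq`.
[cite: Shimura1998, §7.4 Prop. 15, p. 58; §18.6 proof of Thm. 18.6, pp. 128–129] [cite: Milne2005ShimuraVarieties, §13 Prop. 13.1 p. 117] -/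
theorem exists_hom_baseChange_map_r_eq_of_hom (hk : #k ≤ ℵ₀) {lam : A ⟶ B} {c₀ : K} (hc₀ : c₀ ≠ 0)
    (hlam : ∀ u : K, AlgPoints.map (Hom.baseChange ℂ lam).hom.hom.hom (ξ.r u) = η.r (c₀ * u))
    {γ : K} (hγ : γ ∈ ((𝔞 : FractionalIdeal (𝓞 K)⁰ K)⁻¹ * 𝔟 : FractionalIdeal (𝓞 K)⁰ K)) :
    ∃ ν : A ⟶ B, (∀ a : 𝓞 K, (ιA a : A ⟶ A) ≫ ν = ν ≫ (ιB a : B ⟶ B)) ∧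
      ∀ u : K, AlgPoints.map (Hom.baseChange ℂ ν).hom.hom.hom (ξ.r u) = η.r (γ * u) := by
  -- the holomorphic `S(γ)` is a homomorphism over `ℂ`
  obtain ⟨ν', -, hν'⟩ := ξ.exists_hom_forall_map_r_eq η hγ
  -- `n γ = c₀ b`
  obtain ⟨n, b, hn0, hnγ⟩ := exists_nat_mul_eq_mul_coe γ hc₀
  -- `ι_A(n)_ℂ ≫ ν' = (ι_A(b) ≫ λ)_ℂ`: both induce `S(n γ) = S(c₀ b)` on `ξ`
  have hrel : Hom.baseChange ℂ (ιA (n : 𝓞 K) : A ⟶ A) ≫ ν' =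
      Hom.baseChange ℂ ((ιA b : A ⟶ A) ≫ lam) := by
    refine ξ.hom_ext_of_forall_r fun u => ?_
    rw [map_hom_comp, ξ.baseChange_map_r_eq_of_eq_ι, hν', Hom.baseChange_comp, map_hom_comp,
      ξ.baseChange_map_r_eq_of_eq_ι, hlam]
    change η.r (γ * (algebraMap (𝓞 K) K (n : 𝓞 K) * u)) = η.r (c₀ * (algebraMap (𝓞 K) K b * u))
    rw [map_natCast]
    congr 1
    linear_combination u * hnγ
  -- `ι_A(n) = [n]` is a `k`-isogeny, so `ν'` descends
  obtain ⟨ν, hν, -⟩ :=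
    exists_baseChange_eq_comp_eq_of_isIsogeny_complex hk (isIsogeny_ι_natCast ιA hn0) ν' hrel
  have hνr : ∀ u : K, AlgPoints.map (Hom.baseChange ℂ ν).hom.hom.hom (ξ.r u) = η.r (γ * u) := fun u => by
    rw [hν]; exact hν' u
  exact ⟨ν, fun a => ξ.comp_eq_comp_of_forall_baseChange_map_r_eq η hνr a, hνr⟩

/-- **… and `λ_γ` is unique** (an `L`-homomorphism is determined by its complexification on `r(K)`,
`hom_eq_of_forall_baseChange_map_r_eq`). [cite: Shimura1998, §7.4 Prop. 15 and proof of Prop. 17, p. 58] -/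
theorem existsUnique_hom_baseChange_map_r_eq_of_hom (hk : #k ≤ ℵ₀) {lam : A ⟶ B} {c₀ : K} (hc₀ : c₀ ≠ 0)
    (hlam : ∀ u : K, AlgPoints.map (Hom.baseChange ℂ lam).hom.hom.hom (ξ.r u) = η.r (c₀ * u))
    {γ : K} (hγ : γ ∈ ((𝔞 : FractionalIdeal (𝓞 K)⁰ K)⁻¹ * 𝔟 : FractionalIdeal (𝓞 K)⁰ K)) :
    ∃! ν : A ⟶ B, ∀ u : K, AlgPoints.map (Hom.baseChange ℂ ν).hom.hom.hom (ξ.r u) = η.r (γ * u) := by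
  obtain ⟨ν, -, hν⟩ := ξ.exists_hom_baseChange_map_r_eq_of_hom η hk hc₀ hlam hγ
  exact ⟨ν, hν, fun ν' hν' => ξ.hom_eq_of_forall_baseChange_map_r_eq fun u => by rw [hν', hν]⟩

/-- **The case of the named fact** (`c₀ = 1`, `𝔮 𝔟 = 𝔞`): from the `k`-rational `𝔮`-multiplication `λ`
(`λ_ℂ(ξ.r u) = η.r u`) every `γ ∈ 𝔮⁻¹` has its `k`-rational `λ_γ : A → B` with `(λ_γ)_ℂ(ξ.r u) = η.r (γ u)` — the
`λ_{γᵢ}` of the decomposition `λ = Σᵢ ι_A(αᵢ) λ_{γᵢ}`. [cite: Shimura1998, §7.4 Prop. 15, p. 58; §18.6 pp. 128–129] -/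
theorem exists_hom_baseChange_map_r_eq_of_qMultiplication (hk : #k ≤ ℵ₀) (𝔮 : Ideal (𝓞 K))
    (h𝔮𝔟 : (𝔮 : FractionalIdeal (𝓞 K)⁰ K) * (𝔟 : FractionalIdeal (𝓞 K)⁰ K) = 𝔞) {lam : A ⟶ B}
    (hlam : ∀ u : K, AlgPoints.map (Hom.baseChange ℂ lam).hom.hom.hom (ξ.r u) = η.r u)
    {γ : K} (hγ : γ ∈ ((𝔮 : FractionalIdeal (𝓞 K)⁰ K)⁻¹ : FractionalIdeal (𝓞 K)⁰ K)) :
    ∃ ν : A ⟶ B, (∀ a : 𝓞 K, (ιA a : A ⟶ A) ≫ ν = ν ≫ (ιB a : B ⟶ B)) ∧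
      ∀ u : K, AlgPoints.map (Hom.baseChange ℂ ν).hom.hom.hom (ξ.r u) = η.r (γ * u) := by
  rw [← inv_mul_eq_inv_coeIdeal_of_coeIdeal_mul_eq 𝔞 𝔟 𝔮 h𝔮𝔟] at hγ
  exact ξ.exists_hom_baseChange_map_r_eq_of_hom η hk one_ne_zero (fun u => by rw [one_mul]; exact hlam u) hγ

end BaseChangeShape

/-! ## §2 `k`-shape (the binders of `shimuraTaniyamaPair_degOne'`) -/

section KShape

variable {K : Type} [Field K] [NumberField K] {Φ : CMType K} {𝔞 𝔟 : (FractionalIdeal (𝓞 K)⁰ K)ˣ}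
  {k : Type} [Field k] [Algebra k ℂ] {A B : AbelianVariety k}
  {ιA : 𝓞 K →+* End A} {ιB : 𝓞 K →+* End B}
  (ξ₀ : CMTypeUniformization Φ 𝔞 A ιA) (η₀ : CMTypeUniformization Φ 𝔟 B ιB)

/-- **All `S(γ)`-multiplications `A → B` are rational over `k` as soon as one is — `k`-shape uniformisations**
(`ξ₀ : ℂ^Φ/D(𝔞) → A(ℂ)`, `η₀ : ℂ^Φ/D(𝔟) → B(ℂ)` of the `k`-varieties, as bound by the named fact
`shimuraTaniyamaPair_degOne'`): from one `k`-homomorphism `λ` with `λ(ξ₀.r u) = η₀.r (c₀ u)`, `c₀ ≠ 0`, every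
`γ ∈ 𝔞⁻¹𝔟` has an `𝔬_K`-linear `k`-homomorphism `λ_γ : A → B` with `λ_γ(ξ₀.r u) = η₀.r (γ u)` (pass to the base-change
shape by `exists_baseChange_map_baseChange_r_eq`, apply §1, come back along `A(ℂ) ≃ (A ⊗ ℂ)(ℂ)`).
[cite: Shimura1998, §7.4 Prop. 15, p. 58; §18.6 proof of Thm. 18.6, pp. 128–129] [cite: Milne2005ShimuraVarieties, §13 Prop. 13.1 p. 117] -/
theorem exists_hom_map_r_eq_of_hom (hk : #k ≤ ℵ₀) {lam : A ⟶ B} {c₀ : K} (hc₀ : c₀ ≠ 0)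
    (hlam : ∀ u : K, AlgPoints.map lam.hom.hom.hom (ξ₀.r u) = η₀.r (c₀ * u))
    {γ : K} (hγ : γ ∈ ((𝔞 : FractionalIdeal (𝓞 K)⁰ K)⁻¹ * 𝔟 : FractionalIdeal (𝓞 K)⁰ K)) :
    ∃ ν : A ⟶ B, (∀ a : 𝓞 K, (ιA a : A ⟶ A) ≫ ν = ν ≫ (ιB a : B ⟶ B)) ∧
      ∀ u : K, AlgPoints.map ν.hom.hom.hom (ξ₀.r u) = η₀.r (γ * u) := by
  obtain ⟨ξ, η, hξ, hη, hlam'⟩ := exists_baseChange_map_baseChange_r_eq ξ₀ η₀ lam c₀ hlam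
  obtain ⟨ν, hνι, hν⟩ := ξ.exists_hom_baseChange_map_r_eq_of_hom η hk hc₀ hlam' hγ
  refine ⟨ν, hνι, fun u => ?_⟩
  rw [← hξ, ← hη, ofBaseChange_r, ofBaseChange_r, ← pointsEquiv_symm_map_hom, hν]

/-- **… unique** (a `k`-homomorphism out of a uniformised `(A, ι)` is determined by its values on `r(K)`,
`hom_eq_of_forall_r`). [cite: Shimura1998, §7.4 proof of Prop. 17, p. 58] -/
theorem existsUnique_hom_map_r_eq_of_hom (hk : #k ≤ ℵ₀) {lam : A ⟶ B} {c₀ : K} (hc₀ : c₀ ≠ 0)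
    (hlam : ∀ u : K, AlgPoints.map lam.hom.hom.hom (ξ₀.r u) = η₀.r (c₀ * u))
    {γ : K} (hγ : γ ∈ ((𝔞 : FractionalIdeal (𝓞 K)⁰ K)⁻¹ * 𝔟 : FractionalIdeal (𝓞 K)⁰ K)) :
    ∃! ν : A ⟶ B, ∀ u : K, AlgPoints.map ν.hom.hom.hom (ξ₀.r u) = η₀.r (γ * u) := by
  obtain ⟨ξ, η, hξ, hη, hlam'⟩ := exists_baseChange_map_baseChange_r_eq ξ₀ η₀ lam c₀ hlam
  obtain ⟨ν, -, hν⟩ := ξ.exists_hom_baseChange_map_r_eq_of_hom η hk hc₀ hlam' hγ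
  refine ⟨ν, fun u => ?_, fun ν' hν' => ?_⟩
  · rw [← hξ, ← hη, ofBaseChange_r, ofBaseChange_r, ← pointsEquiv_symm_map_hom, hν]
  · refine ξ.hom_eq_of_forall_baseChange_map_r_eq fun u => ?_
    rw [hν, map_baseChange_r_eq_of_ofBaseChange_r ξ η ν' u (γ * u) (by rw [hξ, hη]; exact hν' u)]

/-- **The binders of the named fact**: with `𝔮 𝔟 = 𝔞` and the `𝔮`-multiplication `λ` pinned by
«`λ(ξ₀(q(u))) = η₀(q(u))`» (the hypothesis `_hlam` of `shimuraTaniyamaPair_degOne'`, verbatim), every `γ ∈ 𝔮⁻¹` has a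
`k`-rational, `𝔬_K`-linear `λ_γ : A → B` with `λ_γ(ξ₀.r u) = η₀.r (γ u)` — the multiplications of the decomposition
`λ = Σᵢ ι_A(αᵢ) λ_{γᵢ}` (`αᵢ ∈ 𝔮`, `γᵢ ∈ 𝔮⁻¹`, `Σ αᵢγᵢ = 1`) of the μ-free road, all over `k`.
[cite: Shimura1998, §7.4 Prop. 15, p. 58; §18.6 proof of Thm. 18.6, pp. 128–129] -/
theorem exists_hom_map_r_eq_of_qMultiplication (hk : #k ≤ ℵ₀) (𝔮 : Ideal (𝓞 K))
    (h𝔮𝔟 : (𝔮 : FractionalIdeal (𝓞 K)⁰ K) * (𝔟 : FractionalIdeal (𝓞 K)⁰ K) = 𝔞) {lam : A ⟶ B}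
    (hlam : ∀ u : K, AlgPoints.map lam.hom.hom.hom (ξ₀.r u) = η₀.r u)
    {γ : K} (hγ : γ ∈ ((𝔮 : FractionalIdeal (𝓞 K)⁰ K)⁻¹ : FractionalIdeal (𝓞 K)⁰ K)) :
    ∃ ν : A ⟶ B, (∀ a : 𝓞 K, (ιA a : A ⟶ A) ≫ ν = ν ≫ (ιB a : B ⟶ B)) ∧
      ∀ u : K, AlgPoints.map ν.hom.hom.hom (ξ₀.r u) = η₀.r (γ * u) := by
  rw [← inv_mul_eq_inv_coeIdeal_of_coeIdeal_mul_eq 𝔞 𝔟 𝔮 h𝔮𝔟] at hγ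
  exact exists_hom_map_r_eq_of_hom ξ₀ η₀ hk one_ne_zero (fun u => by rw [one_mul]; exact hlam u) hγ

/-- **`𝔬_K`-linearity of the given `λ` itself** (not a binder of the named fact): a `k`-homomorphism inducing some
`S(c₀)` on `k`-shape uniformisations commutes with the `𝔬_K`-actions («Since `λ` commutes with the operation of `F`»;
base-change shape: `comp_eq_comp_of_forall_baseChange_map_r_eq`). [cite: Shimura1998, §7.4 Prop. 15, p. 58] -/
theorem comp_eq_comp_of_forall_map_r_eq {lam : A ⟶ B} {c₀ : K}
    (hlam : ∀ u : K, AlgPoints.map lam.hom.hom.hom (ξ₀.r u) = η₀.r (c₀ * u)) (a : 𝓞 K) :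
    (ιA a : A ⟶ A) ≫ lam = lam ≫ (ιB a : B ⟶ B) := by
  obtain ⟨ξ, η, -, -, hlam'⟩ := exists_baseChange_map_baseChange_r_eq ξ₀ η₀ lam c₀ hlam
  exact ξ.comp_eq_comp_of_forall_baseChange_map_r_eq η hlam' a

end KShape

end CMTypeUniformization

end Literature.NumberTheory.ComplexMultiplication

end
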